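import Summits.CriticalPhenomena.PercolationContinuityZ3.Theorems.SahiMasterFamilyLower
import Summits.CriticalPhenomena.PercolationContinuityZ3.Theorems.SahiMasterFamilyEqImpliesNonneg
import Literature.Combinatorics.Sahi2008.PushForward
import Literature.Probability.LatticeModels.SahiE3Reflection

/-!
# Transfer to DECREASING events (the percolation separations): `MasterFamilyNonnegLower k ↔ MasterFamilyNonneg k` and
# `MasterFamilyEqIffLower k ↔ MasterFamilyEqIff k`, every `k`

Companion of `SahiMasterFamily.lean` / `SahiMasterFamilyLower.lean` (crux `NoHeavyLowerTail`, stmt-CriticalPhenomena-4575; cell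
`prim-masterthm`, unit `prim-masterthm-p4`).  The one-cut rows are stated on group SEPARATIONS `D[X|Y]`, which are decreasing
events; `SahiMasterFamilyLower.lean` proved the decreasing equality statement `MasterFamilyEqIffLower k` only for `k ≤ 2` (by hand,
through `Cov(1_D, 1_{D'}) = Cov(1_{Dᶜ}, 1_{D'ᶜ})`), and `SahiMasterFamily.lean` announces `masterFamilyNonnegLower_iff` without
proving it.  Here the transfer is done once and for all `k` by COMPLEMENTATION OF CONFIGURATIONS `ω ↦ ωᶜ` (not of events):
* `bernoulliWeight_compl`: `w_p(ωᶜ) = w_{1−p}(ω)`; hence (push-forward along the involution `compl`,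
  `Literature.Combinatorics.Sahi2008.sahiE_pushWeight`) `sahiE_ind_eq_sahiE_ind_preimage_compl`:
  `E_k(μ_p; 1_{D_0},…,1_{D_{k−1}}) = E_k(μ_{1−p}; 1_{D'_0},…,1_{D'_{k−1}})` with `D'_j = compl ⁻¹' D_j = {ω | ωᶜ ∈ D_j}`
  (increasing iff `D_j` is decreasing);
* the zero-flag class, `DeterminedBy`, inclusions and "independent member" are invariant under `D ↦ compl ⁻¹' D`
  (`suppZeroFlag_preimage_compl_iff`, `determinedBy_preimage_compl_iff`), and the co-cylinder `{ω | ω ∩ S = ∅}` ("all coordinates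
  of `S` closed") becomes the cylinder `{ω | S ⊆ ω}`;
* THEOREMS (every `k`): `masterFamilyNonnegLower_iff`, `masterFamilyEqIffLower_iff` (so every increasing-side result of the cell —
  strata theorems, heredity, the typed `k → k+1` step — holds verbatim for decreasing families; the decreasing form of the step off
  the residual class, with co-cylinders "all coordinates of `S` closed", is `SahiMasterFamilyLowerResidualStep.lean`).
HONEST FRAMING: nothing here asserts `C_k` or (EQ-k) for `k ≥ 3`. [this work]
-/

set_option autoImplicit false

open Finset
open scoped Classical
open scoped unitInterval

namespace Summit.CriticalPhenomena.PercolationContinuityZ3.Theorems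

open Literature.Combinatorics.Sahi2008
open MeasureTheory Function
open Literature.Probability.LatticeModels (isUpperSet_preimage_compl isLowerSet_preimage_compl)
open Literature.Probability.Percolation (DeterminedBy determinedBy_iff)
open Literature.Probability.Percolation.DecisionTree (ind ind_of_mem ind_of_not_mem ind_nonneg)

variable {ι : Type} [Fintype ι]

/-! ### Complementation of configurations -/

/-- `w_p(ωᶜ) = w_{1−p}(ω)`. [cite: Sahi2008, eq. (2) (p. 210)] -/
theorem bernoulliWeight_compl (p : ι → unitInterval) (ω : Set ι) :
    bernoulliWeight p ωᶜ = bernoulliWeight (fun e => σ (p e)) ω := by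
  show Literature.Probability.Percolation.BHK2006.weight _ ωᶜ = Literature.Probability.Percolation.BHK2006.weight _ ω
  unfold Literature.Probability.Percolation.BHK2006.weight
  dsimp only
  refine Finset.prod_congr rfl fun e _ => ?_
  by_cases he : e ∈ ω
  · rw [if_neg (fun h => h he), if_pos he, unitInterval.coe_symm_eq]
  · rw [if_pos (show e ∈ ωᶜ from he), if_neg he, unitInterval.coe_symm_eq, sub_sub_cancel]

omit [Fintype ι] in
/-- The flipped parameters are again in the open cube. [folklore] -/
theorem symm_mem_Ioo_iff (p : ι → unitInterval) :
    (∀ e, ((σ (p e) : unitInterval) : ℝ) ∈ Set.Ioo (0 : ℝ) 1) ↔ ∀ e, (p e : ℝ) ∈ Set.Ioo (0 : ℝ) 1 := by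
  refine forall_congr' fun e => ?_
  rw [unitInterval.coe_symm_eq]
  constructor
  · rintro ⟨h1, h2⟩; exact ⟨by linarith, by linarith⟩
  · rintro ⟨h1, h2⟩; exact ⟨by linarith, by linarith⟩

/-- The product weight is the push-forward of the flipped product weight along `compl`. [cite: Sahi2008, eq. (2) (p. 210)] -/
theorem pushWeight_bernoulliWeight_compl (p : ι → unitInterval) :
    pushWeight (bernoulliWeight fun e => σ (p e)) (compl : Set ι → Set ι) = bernoulliWeight p := by
  funext ω
  have h1 : pushWeight (bernoulliWeight fun e => σ (p e)) (compl : Set ι → Set ι) ω =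
      bernoulliWeight (fun e => σ (p e)) ωᶜ := by
    rw [show (compl : Set ι → Set ι) = ⇑(compl_involutive.toPerm (compl : Set ι → Set ι)) from
      (Function.Involutive.coe_toPerm _).symm, pushWeight_equiv, Function.Involutive.toPerm_symm,
      Function.Involutive.coe_toPerm]
  rw [h1, bernoulliWeight_compl]
  congr 1
  funext e
  exact unitInterval.symm_symm _

/-- **`E_k` of decreasing events = `E_k` of the complemented-configuration events under the flipped weight**:
`E_k(μ_p; 1_{D_0},…,1_{D_{k−1}}) = E_k(μ_{1−p}; 1_{compl⁻¹' D_0},…)`. [this work] -/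
theorem sahiE_ind_eq_sahiE_ind_preimage_compl (p : ι → unitInterval) {k : ℕ} (D : Fin k → Set (Set ι)) :
    sahiE (bernoulliWeight p) k (fun j => ind (D j)) =
      sahiE (bernoulliWeight fun e => σ (p e)) k (fun j => ind (compl ⁻¹' (D j))) := by
  rw [← pushWeight_bernoulliWeight_compl p, sahiE_pushWeight]
  rfl

omit [Fintype ι] in
/-- Configurations agreeing on `F` have complements agreeing on `F`. [folklore] -/
theorem compl_inter_eq_of_inter_eq {ω ω' F : Set ι} (h : ω ∩ F = ω' ∩ F) : ωᶜ ∩ F = ω'ᶜ ∩ F := by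
  rw [← Set.sdiff_eq_compl_inter, ← Set.sdiff_eq_compl_inter, ← Set.sdiff_inter_self_eq_sdiff, h,
    Set.sdiff_inter_self_eq_sdiff]

omit [Fintype ι] in
/-- `DeterminedBy` is invariant under complementing configurations. [folklore] -/
theorem determinedBy_preimage_compl_iff (A : Set (Set ι)) (F : Set ι) :
    DeterminedBy (compl ⁻¹' A) F ↔ DeterminedBy A F := by
  rw [determinedBy_iff, determinedBy_iff]
  constructor
  · intro h ω ω' hωω'
    have h1 := h ωᶜ ω'ᶜ (compl_inter_eq_of_inter_eq hωω')
    simpa only [Set.mem_preimage, compl_compl] using h1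
  · intro h ω ω' hωω'
    simpa only [Set.mem_preimage] using h ωᶜ ω'ᶜ (compl_inter_eq_of_inter_eq hωω')

omit [Fintype ι] in
/-- Complementing configurations twice. [folklore] -/
theorem preimage_compl_preimage_compl (A : Set (Set ι)) : compl ⁻¹' (compl ⁻¹' A) = A := by
  ext ω; simp

omit [Fintype ι] in
/-- Flipping the parameters twice. [folklore] -/
theorem symm_symm_params (p : ι → unitInterval) : (fun e => σ ((fun e' => σ (p e')) e)) = p :=
  funext fun _ => unitInterval.symm_symm _

omit [Fintype ι] in
/-- **The zero-flag class is invariant under complementing configurations** (it only sees intersections and determining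
sets). [this work] -/
theorem suppZeroFlag_preimage_compl_iff :
    ∀ (k : ℕ) (U : Fin k → Set (Set ι)), SuppZeroFlag k (fun j => compl ⁻¹' U j) ↔ SuppZeroFlag k U
  | 0, _ => Iff.rfl
  | 1, U => by
    show compl ⁻¹' U 0 = ∅ ↔ U 0 = ∅
    constructor
    · intro h
      rw [← preimage_compl_preimage_compl (U 0), h, Set.preimage_empty]
    · intro h
      rw [h, Set.preimage_empty]
  | 2, U => by
    show (∃ S T : Finset ι, Disjoint S T ∧ DeterminedBy (compl ⁻¹' U 0) (↑S : Set ι) ∧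
        DeterminedBy (compl ⁻¹' U 1) (↑T : Set ι)) ↔
      ∃ S T : Finset ι, Disjoint S T ∧ DeterminedBy (U 0) (↑S : Set ι) ∧ DeterminedBy (U 1) (↑T : Set ι)
    simp only [determinedBy_preimage_compl_iff]
  | k + 3, U => by
    show (∃ i : Fin (k + 3), SuppZeroFlag (k + 2) (fun j => compl ⁻¹' U (i.succAbove j)) ∧
        ∀ l : Fin (k + 2), SuppZeroFlag (k + 2)
          (update (fun j => compl ⁻¹' U (i.succAbove j)) l (compl ⁻¹' U (i.succAbove l) ∩ compl ⁻¹' U i))) ↔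
      ∃ i : Fin (k + 3), SuppZeroFlag (k + 2) (fun j => U (i.succAbove j)) ∧
        ∀ l : Fin (k + 2), SuppZeroFlag (k + 2) (update (fun j => U (i.succAbove j)) l (U (i.succAbove l) ∩ U i))
    refine exists_congr fun i => and_congr (suppZeroFlag_preimage_compl_iff (k + 2) _) (forall_congr' fun l => ?_)
    have e : update (fun j => compl ⁻¹' U (i.succAbove j)) l (compl ⁻¹' U (i.succAbove l) ∩ compl ⁻¹' U i) =
        fun j => compl ⁻¹' (update (fun j => U (i.succAbove j)) l (U (i.succAbove l) ∩ U i) j) := by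
      funext j
      by_cases hj : j = l
      · subst hj; simp only [update_self, Set.preimage_inter]
      · simp only [update_of_ne hj]
    rw [e]
    exact suppZeroFlag_preimage_compl_iff (k + 2) _

/-! ### The master statements: decreasing ↔ increasing, every `k` -/

/-- **`MasterFamilyNonnegLower k ↔ MasterFamilyNonneg k`** (every `k`): Sahi's `C_k` on product measures for decreasing events is the
same statement as for increasing events (complement the configurations and flip `p ↦ 1 − p`). [this work] -/
theorem masterFamilyNonnegLower_iff (k : ℕ) : MasterFamilyNonnegLower k ↔ MasterFamilyNonneg k := by
  constructor
  · intro h ι _ p U hU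
    have h1 := h ι (fun e => σ (p e)) (fun j => compl ⁻¹' U j) fun j => isLowerSet_preimage_compl (hU j)
    rw [sahiE_ind_eq_sahiE_ind_preimage_compl] at h1
    simpa only [preimage_compl_preimage_compl, symm_symm_params] using h1
  · intro h ι _ p D hD
    rw [sahiE_ind_eq_sahiE_ind_preimage_compl]
    exact h ι _ _ fun j => isUpperSet_preimage_compl (hD j)

/-- **`MasterFamilyEqIffLower k ↔ MasterFamilyEqIff k`** (every `k`): the conjectured zero locus `Z_k` for decreasing events is the
same statement as for increasing events. [this work] -/
theorem masterFamilyEqIffLower_iff (k : ℕ) : MasterFamilyEqIffLower k ↔ MasterFamilyEqIff k := by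
  constructor
  · intro h ι _ p hp U hU
    have h1 := h ι (fun e => σ (p e)) ((symm_mem_Ioo_iff p).2 hp) (fun j => compl ⁻¹' U j)
      fun j => isLowerSet_preimage_compl (hU j)
    rw [sahiE_ind_eq_sahiE_ind_preimage_compl, suppZeroFlag_preimage_compl_iff] at h1
    simpa only [preimage_compl_preimage_compl, symm_symm_params] using h1
  · intro h ι _ p hp D hD
    rw [sahiE_ind_eq_sahiE_ind_preimage_compl, ← suppZeroFlag_preimage_compl_iff k D]
    exact h ι _ ((symm_mem_Ioo_iff p).2 hp) _ fun j => isUpperSet_preimage_compl (hD j)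

/-- `MasterFamilyNonnegLower k` for `k ≤ 2` re-derived, and the hierarchy, through the transfer. [this work] -/
theorem masterFamilyNonnegLower_antitone : Antitone MasterFamilyNonnegLower := fun _ _ hkl h =>
  (masterFamilyNonnegLower_iff _).2 (masterFamilyNonneg_antitone hkl ((masterFamilyNonnegLower_iff _).1 h))

/-- `MasterFamilyEqIffLower k` contains `MasterFamilyNonnegLower k` (transfer of `masterFamilyNonneg_of_masterFamilyEqIff`). [this work] -/
theorem masterFamilyNonnegLower_of_masterFamilyEqIffLower {k : ℕ} (h : MasterFamilyEqIffLower k) :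
    MasterFamilyNonnegLower k :=
  (masterFamilyNonnegLower_iff k).2 (masterFamilyNonneg_of_masterFamilyEqIff ((masterFamilyEqIffLower_iff k).1 h))

end Summit.CriticalPhenomena.PercolationContinuityZ3.Theorems
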